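import Mathlib
import Summits.AtomisticToContinuum.Crystallization.Theses.ChessboardParticlePlanes
import Summits.AtomisticToContinuum.Crystallization.Theses.LaminarSixThreeThree
import Summits.AtomisticToContinuum.Crystallization.Theses.SurfaceTensionNoFoam
import Summits.AtomisticToContinuum.Crystallization.Theorems.ChessboardParticlePlanesLjLaminarWindowsGoodCentre
import Summits.AtomisticToContinuum.Crystallization.Theorems.ChessboardParticlePlanesLjLaminarWindowsWindowFloor
import Summits.AtomisticToContinuum.Crystallization.Theorems.ChessboardParticlePlanesLjLaminarWindowsAveragingIntegrals
import Summits.AtomisticToContinuum.Crystallization.Theorems.ChessboardParticlePlanesLjLaminarWindowsWindowTransferThick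
import Summits.AtomisticToContinuum.Crystallization.Theorems.ChessboardParticlePlanesLjLaminarWindowsGlueLevels
import HarnessLib

/-!
# GLUE `LjLaminarity (14293) → NoFoam (13453) → LjLaminarWindows (6711)`: the composition of line `Sketch`, landed

`glue_composition` (lead prover-line-stmt-AtomisticToContinuum-6711-0, rev. 3, verbatim): laminarity
density + separation density + no foam + window floor + averaging integrals + good-centre selection +
window transfer ⟹ the crux, by continuous averaging of `E_int(B_L(c)) − 2(e*+ε′)#B_L(c) + λ·#shell`
over centres `c ∈ ℝ³`, a good centre off the bad set, a particle within `a = max r₀ 1` of it (no foam),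
transfer to `B_L(x_i)`, levels ⇒ isometry.  `stub_glue` (registered stub of the line, lead c1) feeds it
the landed inputs `windowFloor` p103349, `averagingIntegrals` p103618, `goodCentre` p103339,
`stub_windowTransfer` p106066, `stub_separationDensity` (from `stub_minDistance07`, p115815): the crux
now follows from the two board items `LjLaminarity` (stmt-14293) and `NoFoam` (stmt-13453) alone.
-/

noncomputable section

open scoped BigOperators
open MeasureTheory Metric Filter Topology
open Literature.MathematicalPhysics.StatisticalMechanics
open Summit.AtomisticToContinuum.Crystallization.Theorems.ChargedEnergyGapNegative

namespace Summit.AtomisticToContinuum.Crystallization.Theorems.LjLaminarWindowsSketch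

/-- **Composition** (rev. 3): the seven inputs imply the crux (unfolded statement). [folklore] -/
theorem glue_composition :
    (∀ t R : ℝ, 0 < t → 0 < R → ∀ x : (N : ℕ) → (Fin N → EuclideanSpace ℝ (Fin 3)),
      (∀ N, IsGroundState lennardJones (x N)) →
      Filter.Tendsto (fun N : ℕ => (Nat.card {i : Fin N // ¬ (∃ n : EuclideanSpace ℝ (Fin 3),
        ‖n‖ = 1 ∧ ∃ c : ℤ → ℝ, (∀ k : ℤ, c k + 3 / 4 ≤ c (k + 1)) ∧ ∀ j : Fin N,
          dist (x N j) (x N i) ≤ R → ∃ k : ℤ, |inner ℝ (x N j - x N i) n - c k| ≤ t)} : ℝ) / N)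
        Filter.atTop (nhds 0)) →
    (∀ R : ℝ, 0 < R → ∀ x : (N : ℕ) → (Fin N → EuclideanSpace ℝ (Fin 3)),
      (∀ N, IsGroundState lennardJones (x N)) →
      Filter.Tendsto (fun N : ℕ => (Nat.card {i : Fin N // ∃ j k : Fin N, j ≠ k ∧
        dist (x N j) (x N i) ≤ R ∧ dist (x N k) (x N i) ≤ R ∧ dist (x N j) (x N k) < 7 / 10} : ℝ) / N)
        Filter.atTop (nhds 0)) →
    (∃ r₀ : ℝ, 0 < r₀ ∧ ∀ R : ℝ, 0 < R → ∀ x : (N : ℕ) → (Fin N → EuclideanSpace ℝ (Fin 3)),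
      (∀ N, IsGroundState lennardJones (x N)) →
      Filter.Tendsto (fun N : ℕ => (Nat.card {i : Fin N // ∃ c : EuclideanSpace ℝ (Fin 3),
        dist c (x N i) ≤ R ∧ ∀ j : Fin N, r₀ ≤ dist c (x N j)} : ℝ) / N) Filter.atTop (nhds 0)) →
    (∀ (N : ℕ) (x : Fin N → E3), Function.Injective x → ∀ (c : E3) (L : ℝ),
      2 * eStar * ((Finset.univ.filter fun j : Fin N => dist (x j) c ≤ L).card : ℝ) ≤
        ∑ j : Fin N, ∑ k : Fin N,
          if j ≠ k ∧ dist (x j) c ≤ L ∧ dist (x k) c ≤ L then lennardJones (dist (x j) (x k)) else 0) →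
    (∀ (N : ℕ) (x : Fin N → E3) (δ L : ℝ), 0 < δ → 1 ≤ L → Function.Injective x →
      (∀ j k : Fin N, j ≠ k → δ ≤ dist (x j) (x k)) →
      Integrable (fun c : E3 => ((Finset.univ.filter fun j : Fin N => dist (x j) c ≤ L).card : ℝ)) ∧
      Integrable (fun c : E3 =>
        ((Finset.univ.filter fun j : Fin N => L - 1 < dist (x j) c ∧ dist (x j) c ≤ L + 1).card : ℝ)) ∧
      Integrable (fun c : E3 => ∑ j : Fin N, ∑ k : Fin N,
        if j ≠ k ∧ dist (x j) c ≤ L ∧ dist (x k) c ≤ L then lennardJones (dist (x j) (x k)) else 0) ∧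
      (∫ c : E3, ((Finset.univ.filter fun j : Fin N => dist (x j) c ≤ L).card : ℝ)) =
        N * (4 / 3 * Real.pi * L ^ 3) ∧
      (∫ c : E3,
        ((Finset.univ.filter fun j : Fin N => L - 1 < dist (x j) c ∧ dist (x j) c ≤ L + 1).card : ℝ)) ≤
        11 * Real.pi * L ^ 2 * N ∧
      (∫ c : E3, ∑ j : Fin N, ∑ k : Fin N,
        if j ≠ k ∧ dist (x j) c ≤ L ∧ dist (x k) c ≤ L then lennardJones (dist (x j) (x k)) else 0) ≤
        (4 / 3 * Real.pi * L ^ 3) * (2 * interactionEnergy lennardJones x) + 530 * δ⁻¹ ^ 5 * L ^ 2 * N) →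
    (∀ (G w : E3 → ℝ) (D : Set E3) (N : ℕ) (s : Finset (Fin N)) (z : Fin N → E3) (r : Fin N → ℝ)
      (A ε P : ℝ), 0 < ε → 0 < A → 0 ≤ P → Integrable G → Integrable w →
      (∀ c, -(2 * ε * w c) ≤ G c) → (∀ c, 0 ≤ w c) → (∀ c, w c ≤ P) →
      (∫ c, G c) ≤ -A → MeasurableSet D →
      (∀ c ∈ D, w c ≠ 0 → ∃ m ∈ s, dist c (z m) ≤ r m) → (∀ m ∈ s, 0 ≤ r m) →
      P * ∑ m ∈ s, (4 / 3 * Real.pi * (r m) ^ 3) ≤ A / (4 * ε) →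
      ∃ c, c ∉ D ∧ G c < 0) →
    (∀ (N : ℕ) (x : Fin N → E3) (V : ℝ → ℝ) (c : E3) (i : Fin N) (a L M e ε lam : ℝ),
      dist (x i) c ≤ a → 0 ≤ M → 0 < ε → e + ε ≤ 0 →
      2 * M ≤ lam → 4 * ε ≤ lam → 4 * |e + ε| ≤ lam →
      (∀ j : Fin N, ∑ k ∈ Finset.univ.erase j, |V (dist (x j) (x k))| ≤ M) →
      (∑ j : Fin N, ∑ k : Fin N,
          if j ≠ k ∧ dist (x j) c ≤ L ∧ dist (x k) c ≤ L then V (dist (x j) (x k)) else 0) +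
        lam * ((Finset.univ.filter fun j : Fin N => L - a < dist (x j) c ∧ dist (x j) c ≤ L + a).card : ℝ)
        ≤ 2 * (e + ε) * ((Finset.univ.filter fun j : Fin N => dist (x j) c ≤ L).card : ℝ) →
      2 * e * ((Finset.univ.filter fun j : Fin N => dist (x j) c ≤ L).card : ℝ) ≤
        (∑ j : Fin N, ∑ k : Fin N,
          if j ≠ k ∧ dist (x j) c ≤ L ∧ dist (x k) c ≤ L then V (dist (x j) (x k)) else 0) →
      (∑ j : Fin N, ∑ k : Fin N,
          if j ≠ k ∧ dist (x j) (x i) ≤ L ∧ dist (x k) (x i) ≤ L then V (dist (x j) (x k)) else 0) ≤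
        2 * (e + 2 * ε) * (Nat.card {j : Fin N // dist (x j) (x i) ≤ L} : ℝ)) →
    ∀ x : (N : ℕ) → (Fin N → EuclideanSpace ℝ (Fin 3)), (∀ N, IsGroundState lennardJones (x N)) →
      ∀ η ε : ℝ, 0 < η → 0 < ε → ∃ L₀ : ℝ, ∀ L : ℝ, L₀ ≤ L → ∃ᶠ N in Filter.atTop,
        ∃ (i : Fin N) (A : EuclideanSpace ℝ (Fin 3) →ₗᵢ[ℝ] EuclideanSpace ℝ (Fin 3)) (T : Set ℝ),
          (∀ t ∈ T, ∀ t' ∈ T, t ≠ t' → (3 : ℝ) / 4 ≤ |t - t'|) ∧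
          (∀ j k : Fin N, j ≠ k → dist (x N j) (x N i) ≤ L → dist (x N k) (x N i) ≤ L →
            (7 : ℝ) / 10 ≤ dist (x N j) (x N k)) ∧
          (∀ j : Fin N, dist (x N j) (x N i) ≤ L → ∃ t ∈ T, |(A (x N j - x N i)) 2 - t| ≤ η) ∧
          (∑ j : Fin N, ∑ k : Fin N, if j ≠ k ∧ dist (x N j) (x N i) ≤ L ∧ dist (x N k) (x N i) ≤ L
              then lennardJones (dist (x N j) (x N k)) else 0) ≤
            2 * ((⨅ Q : PeriodicConfiguration 3, Q.energyPerParticle lennardJones) + ε) *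
              (Nat.card {j : Fin N // dist (x N j) (x N i) ≤ L} : ℝ) := by
  intro hLam hSepD hNoFoam hFloor hAvg hGood hTrans x hx η ε hη hε
  obtain ⟨δ, hδ, hsep⟩ := LennardJonesMinimalDistance_holds
  obtain ⟨r₀, hr₀, hNF⟩ := hNoFoam
  have he : eStar < 0 := by
    obtain ⟨e, he, htend, -⟩ := BlancLewin2015_8_holds 3 (by norm_num) (by norm_num)
    have heq : e = eStar := tendsto_nhds_unique htend crysEnergyLimit
    rw [← heq]
    exact he
  set a : ℝ := max r₀ 1 with ha
  have ha1 : 1 ≤ a := le_max_right _ _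
  have har : r₀ ≤ a := le_max_left _ _
  have ha0 : 0 < a := by linarith
  set ε₁ : ℝ := min ε (-eStar) with hε₁
  have hε₁pos : 0 < ε₁ := lt_min hε (neg_pos.2 he)
  have hε₁le : ε₁ ≤ ε := min_le_left _ _
  have hε₁le' : ε₁ ≤ -eStar := min_le_right _ _
  set ε' : ℝ := ε₁ / 2 with hε'
  have hε'pos : 0 < ε' := by positivity
  set M : ℝ := (δ⁻¹ ^ 6 / 12 + 1 / 6) * (250 * δ⁻¹ ^ 6) with hM
  have hM0 : 0 ≤ M := by positivity
  set lam : ℝ := 2 * M + 4 * ε' + 4 * |eStar| with hlam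
  have hlam0 : 0 ≤ lam := by positivity
  set C : ℝ := 530 * δ⁻¹ ^ 5 + 32 / 3 * Real.pi * a ^ 3 * lam with hC
  have hC0 : 0 ≤ C := by positivity
  set L₀ : ℝ := max (a + 1) (C / (4 / 3 * Real.pi * ε')) with hL₀
  refine ⟨L₀, fun L hL => ?_⟩
  have hLa1 : a + 1 ≤ L := le_trans (le_max_left _ _) hL
  have hL1 : 1 ≤ L := by linarith
  have hLpos : 0 < L := by linarith
  have hLa : a ≤ L := by linarith
  have hLm1 : 1 ≤ L - a := by linarith
  have hLp1 : 1 ≤ L + a := by linarith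
  set v : ℝ := 4 / 3 * Real.pi * L ^ 3 with hv
  have hvpos : 0 < v := by positivity
  have hCL : C * L ^ 2 ≤ ε' * v := by
    have h1 : C / (4 / 3 * Real.pi * ε') ≤ L := le_trans (le_max_right _ _) hL
    have hpos : 0 < 4 / 3 * Real.pi * ε' := by positivity
    rw [div_le_iff₀ hpos] at h1
    have h2 := mul_le_mul_of_nonneg_right h1 (sq_nonneg L)
    have h3 : L * (4 / 3 * Real.pi * ε') * L ^ 2 = ε' * v := by rw [hv]; ring
    linarith
  set P : ℝ := (2 * L / δ + 1) ^ 3 with hP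
  have hPpos : 0 < P := by positivity
  set θ : ℝ := 1 / (24 * P) with hθ
  have hθpos : 0 < θ := by positivity
  have hcl : Tendsto (fun N : ℕ => groundStateEnergy lennardJones 3 N / N) atTop (𝓝 eStar) :=
    crysEnergyLimit
  have hlt : eStar < eStar + ε' / 4 := by linarith only [hε'pos]
  have hE1 : ∀ᶠ N : ℕ in atTop, groundStateEnergy lennardJones 3 N / N < eStar + ε' / 4 :=
    hcl.eventually (gt_mem_nhds hlt)
  have hE2 := (hLam η L hη hLpos x hx).eventually (gt_mem_nhds hθpos)
  have hE2' := (hSepD L hLpos x hx).eventually (gt_mem_nhds hθpos)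
  have hE3 := (hNF (a + 2) (by linarith) x hx).eventually (gt_mem_nhds hθpos)
  have hE4 : ∀ᶠ N : ℕ in atTop, 1 ≤ N := eventually_ge_atTop 1
  refine ((hE1.and (hE2.and (hE2'.and (hE3.and hE4)))).mono ?_).frequently
  rintro N ⟨h1, h2, h2', h3, h4⟩
  classical
  have hxN := hx N
  have hinj : Function.Injective (x N) := hxN.1
  have hsepN : ∀ j k : Fin N, j ≠ k → δ ≤ dist (x N j) (x N k) :=
    fun j k hjk => hsep N (x N) hxN j k hjk
  have hNpos : (0 : ℝ) < N := by exact_mod_cast h4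
  have hEN : interactionEnergy lennardJones (x N) ≤ N * (eStar + ε' / 4) := by
    rw [hxN.2]
    have h1' := h1
    rw [div_lt_iff₀ hNpos] at h1'
    linarith only [h1']
  have hdens : ∀ m : ℕ, (m : ℝ) / N < θ → (m : ℝ) ≤ θ * N := by
    intro m hm
    rw [div_lt_iff₀ hNpos] at hm
    exact hm.le
  let sepbad : Fin N → Prop := fun i => ∃ j k : Fin N, j ≠ k ∧
    dist (x N j) (x N i) ≤ L ∧ dist (x N k) (x N i) ≤ L ∧ dist (x N j) (x N k) < 7 / 10
  let lamgood : Fin N → Prop := fun i => ∃ n : EuclideanSpace ℝ (Fin 3), ‖n‖ = 1 ∧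
    ∃ c : ℤ → ℝ, (∀ k : ℤ, c k + 3 / 4 ≤ c (k + 1)) ∧ ∀ j : Fin N,
      dist (x N j) (x N i) ≤ L → ∃ k : ℤ, |inner ℝ (x N j - x N i) n - c k| ≤ η
  let exposedP : Fin N → Prop := fun i =>
    ∃ c : EuclideanSpace ℝ (Fin 3), dist c (x N i) ≤ a + 2 ∧ ∀ j : Fin N, r₀ ≤ dist c (x N j)
  set U : Finset (Fin N) := Finset.univ.filter fun i => sepbad i ∨ ¬ lamgood i with hU
  set X : Finset (Fin N) := Finset.univ.filter fun i => exposedP i with hX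
  have hUcard : (U.card : ℝ) ≤ 2 * θ * N := by
    have hA : (Nat.card {i : Fin N // ¬ lamgood i} : ℝ) ≤ θ * N := hdens _ h2
    have hB : (Nat.card {i : Fin N // sepbad i} : ℝ) ≤ θ * N := hdens _ h2'
    rw [glue_natCard_filter] at hA hB
    have hsub : U ⊆ (Finset.univ.filter fun i => sepbad i) ∪
        (Finset.univ.filter fun i => ¬ lamgood i) := by
      intro i hi
      simp only [hU, Finset.mem_filter, Finset.mem_univ, true_and] at hi
      simp only [Finset.mem_union, Finset.mem_filter, Finset.mem_univ, true_and]
      exact hi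
    have h3 : (U.card : ℝ) ≤ ((Finset.univ.filter fun i => sepbad i).card : ℝ) +
        ((Finset.univ.filter fun i => ¬ lamgood i).card : ℝ) := by
      exact_mod_cast (Finset.card_le_card hsub).trans (Finset.card_union_le _ _)
    linarith only [hA, hB, h3]
  have hXcard : (X.card : ℝ) ≤ θ * N := by
    have h3' : (Nat.card {i : Fin N // exposedP i} : ℝ) ≤ θ * N := hdens _ h3
    rwa [glue_natCard_filter] at h3'
  obtain ⟨hbc_int, -, hbe_int, hbc_eq, -, hbe_le⟩ := hAvg N (x N) δ L hδ hL1 hinj hsepN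
  obtain ⟨hbcP_int, -, -, hbcP_eq, -, -⟩ := hAvg N (x N) δ (L + a) hδ hLp1 hinj hsepN
  obtain ⟨hbcM_int, -, -, hbcM_eq, -, -⟩ := hAvg N (x N) δ (L - a) hδ hLm1 hinj hsepN
  set bc : E3 → ℝ := fun c => ((Finset.univ.filter fun j : Fin N => dist (x N j) c ≤ L).card : ℝ)
    with hbc
  set bcP : E3 → ℝ := fun c =>
    ((Finset.univ.filter fun j : Fin N => dist (x N j) c ≤ L + a).card : ℝ) with hbcP
  set bcM : E3 → ℝ := fun c =>
    ((Finset.univ.filter fun j : Fin N => dist (x N j) c ≤ L - a).card : ℝ) with hbcM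
  set sc : E3 → ℝ := fun c => bcP c - bcM c with hsc
  set be : E3 → ℝ := fun c => ∑ j : Fin N, ∑ k : Fin N,
    if j ≠ k ∧ dist (x N j) c ≤ L ∧ dist (x N k) c ≤ L then lennardJones (dist (x N j) (x N k)) else 0
    with hbe
  set G : E3 → ℝ := fun c => be c - 2 * (eStar + ε') * bc c + lam * sc c with hG
  have hsc_eq : ∀ c : E3, ((Finset.univ.filter fun j : Fin N =>
      L - a < dist (x N j) c ∧ dist (x N j) c ≤ L + a).card : ℝ) = sc c := fun c => by
    simp only [hsc, hbcP, hbcM]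
    exact glue_shell_card N (fun j => dist (x N j) c) L a ha0.le
  have hbc_nonneg : ∀ c, 0 ≤ bc c := fun c => by simp only [hbc]; positivity
  have hsc_nonneg : ∀ c, 0 ≤ sc c := by
    intro c
    rw [← hsc_eq c]
    positivity
  have hfloor : ∀ c, 2 * eStar * bc c ≤ be c := fun c => hFloor N (x N) hinj c L
  have hGfloor : ∀ c, -(2 * ε' * bc c) ≤ G c := by
    intro c
    have h1 := hfloor c
    have h3 : 0 ≤ lam * sc c := mul_nonneg hlam0 (hsc_nonneg c)
    simp only [hG]
    linarith only [h1, h3]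
  have hbc_leP : ∀ c, bc c ≤ P := fun c => by
    simp only [hbc, hP]
    exact glue_ball_card_le N (x N) hinj hδ hsepN c hLpos.le
  have hsc_int : Integrable sc := hbcP_int.sub hbcM_int
  have hG_int : Integrable G :=
    (hbe_int.sub (hbc_int.const_mul (2 * (eStar + ε')))).add (hsc_int.const_mul lam)
  set A : ℝ := ε' * N * v / 2 with hA
  have hApos : 0 < A := by positivity
  have hG_integral : (∫ c, G c) ≤ -A := by
    have i1 : Integrable (fun c => be c - 2 * (eStar + ε') * bc c) :=
      hbe_int.sub (hbc_int.const_mul _)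
    have i2 : Integrable (fun c => lam * sc c) := hsc_int.const_mul lam
    have hsplit : (∫ c, G c) =
        (∫ c, be c) - 2 * (eStar + ε') * (∫ c, bc c) + lam * (∫ c, sc c) := by
      simp only [hG]
      rw [integral_add i1 i2, integral_sub hbe_int (hbc_int.const_mul _), integral_const_mul,
        integral_const_mul]
    have hsc_integral : (∫ c, sc c) = N * (4 / 3 * Real.pi * (L + a) ^ 3) -
        N * (4 / 3 * Real.pi * (L - a) ^ 3) := by
      simp only [hsc]
      rw [integral_sub hbcP_int hbcM_int]
      exact congrArg₂ (· - ·) hbcP_eq hbcM_eq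
    rw [hsplit, hbc_eq, hsc_integral]
    have hbe_le' : (∫ c, be c) ≤
        v * (2 * interactionEnergy lennardJones (x N)) + 530 * δ⁻¹ ^ 5 * L ^ 2 * N := hbe_le
    have ha' : v * (2 * interactionEnergy lennardJones (x N)) ≤
        2 * (v * N * eStar) + 1 / 2 * (v * N * ε') := by
      have h1 := mul_le_mul_of_nonneg_left hEN (by positivity : (0 : ℝ) ≤ 2 * v)
      have h2 : 2 * v * (N * (eStar + ε' / 4)) = 2 * (v * N * eStar) + 1 / 2 * (v * N * ε') := by ring
      have h3 : v * (2 * interactionEnergy lennardJones (x N)) =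
          2 * v * interactionEnergy lennardJones (x N) := by ring
      linarith only [h1, h2, h3]
    have hshell : N * (4 / 3 * Real.pi * (L + a) ^ 3) - N * (4 / 3 * Real.pi * (L - a) ^ 3) ≤
        32 / 3 * Real.pi * a ^ 3 * L ^ 2 * N := glue_shell_volume_le ha1 hL1 hNpos.le
    have hb : lam * (N * (4 / 3 * Real.pi * (L + a) ^ 3) - N * (4 / 3 * Real.pi * (L - a) ^ 3)) ≤
        lam * (32 / 3 * Real.pi * a ^ 3 * L ^ 2 * N) :=
      mul_le_mul_of_nonneg_left hshell hlam0
    have hc : 530 * δ⁻¹ ^ 5 * L ^ 2 * N + lam * (32 / 3 * Real.pi * a ^ 3 * L ^ 2 * N) =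
        C * L ^ 2 * N := by
      simp only [hC]; ring
    have hd : C * L ^ 2 * N ≤ v * N * ε' := by
      have := mul_le_mul_of_nonneg_right hCL hNpos.le
      have h' : ε' * v * N = v * N * ε' := by ring
      linarith only [this, h']
    have he2 : 2 * (eStar + ε') * (↑N * (4 / 3 * Real.pi * L ^ 3)) =
        2 * (v * N * eStar) + 2 * (v * N * ε') := by
      simp only [hv]; ring
    have hA' : -A = -(1 / 2) * (v * N * ε') := by simp only [hA]; ring
    rw [he2, hA']
    linarith only [hbe_le', ha', hb, hc, hd]
  set Far : Set E3 := {c | ∀ j : Fin N, a < dist (x N j) c} with hFar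
  set Zone : Set E3 := ⋃ u ∈ U, closedBall (x N u) a with hZone
  set D : Set E3 := Far ∪ Zone with hD
  have hFar_open : IsOpen Far := by
    have : Far = ⋂ j : Fin N, {c : E3 | a < dist (x N j) c} := by
      ext c; simp [hFar]
    rw [this]
    exact isOpen_iInter_of_finite fun j => isOpen_lt continuous_const (continuous_const.dist continuous_id)
  have hZone_closed : IsClosed Zone := isClosed_biUnion_finset fun u _ => isClosed_closedBall
  have hD_meas : MeasurableSet D := hFar_open.measurableSet.union hZone_closed.measurableSet
  set s : Finset (Fin N) := U ∪ X with hs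
  have hcover : ∀ c ∈ D, bc c ≠ 0 → ∃ m ∈ s, dist c (x N m) ≤ (fun _ : Fin N => L) m := by
    intro c hc hbc0
    rcases hc with hc | hc
    · -- far centre: its nearest particle is exposed
      have hne : (Finset.univ.filter fun j : Fin N => dist (x N j) c ≤ L).Nonempty := by
        rw [Finset.nonempty_iff_ne_empty]
        intro h
        apply hbc0
        simp only [hbc, h, Finset.card_empty, Nat.cast_zero]
      obtain ⟨j₀, hj₀⟩ := hne
      obtain ⟨i, -, hi⟩ := Finset.exists_min_image Finset.univ (fun j => dist (x N j) c)
        ⟨j₀, Finset.mem_univ _⟩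
      have hmin : ∀ j, dist (x N i) c ≤ dist (x N j) c := fun j => hi j (Finset.mem_univ _)
      have hiL : dist (x N i) c ≤ L := le_trans (hmin j₀) (Finset.mem_filter.1 hj₀).2
      have hexp : exposedP i := exposed_of_far (x N) c i har ha0.le hmin (hc i)
      refine ⟨i, ?_, ?_⟩
      · simp only [hs, Finset.mem_union]
        right
        simpa [hX] using hexp
      · simpa [dist_comm] using hiL
    · simp only [hZone, Set.mem_iUnion, mem_closedBall] at hc
      obtain ⟨u, hu, hcu⟩ := hc
      refine ⟨u, ?_, le_trans hcu hLa⟩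
      simp only [hs, Finset.mem_union]
      left
      exact hu
  have hsum : P * ∑ m ∈ s, (4 / 3 * Real.pi * ((fun _ : Fin N => L) m) ^ 3) ≤ A / (4 * ε') := by
    simp only [Finset.sum_const, nsmul_eq_mul]
    have hscard : (s.card : ℝ) ≤ 3 * θ * N := by
      have h01 := Finset.card_union_le U X
      have h02 : (s.card : ℝ) ≤ U.card + X.card := by simp only [hs]; exact_mod_cast h01
      linarith only [h02, hUcard, hXcard]
    have hθN : 3 * θ * N = N / (8 * P) := by simp only [hθ]; field_simp; ring
    have hA4 : A / (4 * ε') = N * v / 8 := by simp only [hA]; field_simp; ring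
    rw [hA4]
    rw [hθN] at hscard
    have : P * (s.card : ℝ) ≤ N / 8 := by
      have h7 := mul_le_mul_of_nonneg_left hscard hPpos.le
      have h8 : P * (N / (8 * P)) = N / 8 := by field_simp
      linarith only [h7, h8]
    have hv' : (4 / 3 * Real.pi * L ^ 3) = v := rfl
    rw [hv']
    have h9 := mul_le_mul_of_nonneg_right this hvpos.le
    have e1 : P * ((s.card : ℝ) * v) = P * (s.card : ℝ) * v := by ring
    have e2 : (N : ℝ) / 8 * v = N * v / 8 := by ring
    linarith only [h9, e1, e2]
  obtain ⟨c, hcD, hGc⟩ := hGood G bc D N s (x N) (fun _ => L) A ε' P hε'pos hApos hPpos.le hG_int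
    hbc_int hGfloor hbc_nonneg hbc_leP hG_integral hD_meas hcover (fun _ _ => hLpos.le) hsum
  have hnear : ∃ i : Fin N, dist (x N i) c ≤ a := by
    by_contra h
    push Not at h
    exact hcD (Or.inl h)
  obtain ⟨i, hic⟩ := hnear
  have hclean : ¬ (sepbad i ∨ ¬ lamgood i) := by
    intro h
    apply hcD
    refine Or.inr ?_
    simp only [hZone, Set.mem_iUnion, mem_closedBall]
    refine ⟨i, ?_, by rwa [dist_comm]⟩
    simpa [hU] using h
  have hsepgood : ¬ sepbad i := fun h => hclean (Or.inl h)
  have hlamgood : lamgood i := by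
    by_contra h
    exact hclean (Or.inr h)
  have hsep7 : ∀ j k : Fin N, j ≠ k → dist (x N j) (x N i) ≤ L → dist (x N k) (x N i) ≤ L →
      (7 : ℝ) / 10 ≤ dist (x N j) (x N k) := by
    intro j k hjk hj hk
    by_contra hlt
    exact hsepgood ⟨j, k, hjk, hj, hk, lt_of_not_ge hlt⟩
  obtain ⟨n, hn, lev, hlev, hwin⟩ := hlamgood
  obtain ⟨A', T, hT, hlamin⟩ := laminar_of_levels (x N) i L η n hn lev hlev hwin
  have heε : eStar + ε' ≤ 0 := by
    simp only [hε']; linarith only [hε₁le', hε₁pos]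
  have habs0 := abs_nonneg eStar
  have h2M : 2 * M ≤ lam := by
    simp only [hlam]; linarith only [habs0, hε'pos]
  have h4ε : 4 * ε' ≤ lam := by
    simp only [hlam]; linarith only [habs0, hM0]
  have h4abs : 4 * |eStar + ε'| ≤ lam := by
    have : |eStar + ε'| ≤ |eStar| + ε' := by
      calc |eStar + ε'| ≤ |eStar| + |ε'| := abs_add_le _ _
        _ = |eStar| + ε' := by rw [abs_of_pos hε'pos]
    simp only [hlam]; linarith only [this, hM0]
  have hrow : ∀ j : Fin N, ∑ k ∈ Finset.univ.erase j, |lennardJones (dist (x N j) (x N k))| ≤ M :=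
    fun j => row_abs_lennardJones_le (x N) hδ hsepN j
  have hgood : be c + lam * ((Finset.univ.filter fun j : Fin N =>
      L - a < dist (x N j) c ∧ dist (x N j) c ≤ L + a).card : ℝ) ≤ 2 * (eStar + ε') * bc c := by
    rw [hsc_eq c]
    have := hGc; simp only [hG] at this; linarith only [this]
  have henergy := hTrans N (x N) lennardJones c i a L M eStar ε' lam hic hM0 hε'pos heε h2M h4ε
    h4abs hrow hgood (hfloor c)
  refine ⟨i, A', T, hT, hsep7, hlamin, le_trans henergy ?_⟩
  have hcard0 : (0 : ℝ) ≤ (Nat.card {j : Fin N // dist (x N j) (x N i) ≤ L} : ℝ) := Nat.cast_nonneg _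
  have hle : 2 * (eStar + 2 * ε') ≤ 2 * (eStar + ε) := by
    simp only [hε']; linarith only [hε₁le]
  exact mul_le_mul_of_nonneg_right hle hcard0

/-- **GLUE (registered stub `stub_glue`)**: the crux `LjLaminarWindows` (stmt-6711) from the board items
`LjLaminarity` (stmt-14293) and `NoFoam` (stmt-13453); all other inputs are landed. [folklore] -/
theorem stub_glue :
    Summit.AtomisticToContinuum.Crystallization.Theses.LaminarSixThreeThree.LjLaminarity →
    Summit.AtomisticToContinuum.Crystallization.Theses.SurfaceTensionNoFoam.NoFoam →
    Summit.AtomisticToContinuum.Crystallization.Theses.ChessboardParticlePlanes.LjLaminarWindows :=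
  fun hLam hNoFoam =>
    glue_composition hLam stub_separationDensity hNoFoam windowFloor averagingIntegrals goodCentre
      stub_windowTransfer

end Summit.AtomisticToContinuum.Crystallization.Theorems.LjLaminarWindowsSketch

end
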